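import Summits.QuantumFields.QCD.Theses.NestedDissectionSea
import Literature.Barriers.QuantumFields.WilsonDeterminantSign
import Summits.QuantumFields.QCD.Theorems.NestedDissectionSeaSeaFactorisationBridgeStubFrullaniToolkit

/-!
# Stub `stub_cleanBoxBound` of line `proper-time-quarantine`
(crux `Summit.QuantumFields.QCD.Theses.NestedDissectionSea.SeaFactorisationBridge`,
item stmt-QuantumFields-13880)

The **clean-box bound** (skeleton r11, stub 4b; deterministic spectral bookkeeping).  On a box that
is not bad, the Dirichlet restriction `H_Ω` of `Γ₅ D_W(m_f(k))` to the clean part `Ω` has all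
eigenvalues of modulus `≥ κ = c_h a_k m_f/Z_m(k)` (support-form coercivity; `Γ₅` is a site-diagonal
sign matrix) and IR mode count `#{|λ_i| ≤ x τ_k} ≤ C_W (K + xK)⁴`, `τ_k = t a_k/(ℓ Z_m(k))`.  As
`tZero reg (ℓ/t) k = τ_k⁻²`, `t₀ λ_i² = (λ_i/τ_k)²` with `|λ_i|/τ_k ≥ x₀ = c_h ℓ m_f/t`, and shell
counting with `E₁(u) ≤ e^{-u}/u` bounds `½ Σ_i E₁(t₀ λ_i²)` by `½ C_W K⁴ S₄ (2 + x₀)⁴ e^{-x₀²}/x₀²`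
(`S₄ = 12288 ≥ Σ_j (j+1)⁴ e^{-j}`), which tends to `0` as `t → 0⁺`.

The theorem `cleanBoxBound` is stated with the skeleton's vocabulary (`CleanBoxBound`, `BadBox`,
`cleanPart`, `CellResonant`, `IsCoerciveOn`, `localModeCount`, `localIrFunctional`, `tZero`,
`expIntE₁`, `QIdx`) UNFOLDED verbatim (through `let`s; a local classical `DecidablePred` instance on
`Ω` makes every hidden instance literally the skeleton's), so that the skeleton's registered stub
`stub_cleanBoxBound : … → CleanBoxBound reg b₀ ℓ m` follows by `exact CleanBox.cleanBoxBound`.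
-/

noncomputable section

namespace Summit.QuantumFields.QCD.Cruxes.SeaFactorisationBridge.ProperTimeQuarantine.CleanBox

open scoped BigOperators Topology Classical MeasureTheory Matrix ComplexConjugate ComplexOrder
open Filter MeasureTheory
open Literature.MathematicalPhysics.QuantumFieldTheory Literature.MathematicalPhysics.QuantumLattice
open Literature.Probability.LatticeModels
open Summit.QuantumFields.QCD.Theses.NestedDissectionSea

/-! ## Scalar toolkit: `E₁` bounds, the shell series, the profile `Φ` -/

/-- `E₁(x) = ∫_{(x,∞)} e^{-s}/s ds` is antitone on `(0, ∞)`. -/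
theorem expInt_antitone {a b : ℝ} (ha : 0 < a) (hab : a ≤ b) :
    ∫ s in Set.Ioi b, Real.exp (-s) / s ≤ ∫ s in Set.Ioi a, Real.exp (-s) / s := by
  refine setIntegral_mono_set (frullani_integrableOn_exp_neg_div ha) ?_
    (Eventually.of_forall (Set.Ioi_subset_Ioi hab))
  filter_upwards [ae_restrict_mem measurableSet_Ioi] with s hs
  exact div_nonneg (Real.exp_pos _).le (ha.trans hs).le

/-- The shell series is bounded: `Σ_{j<J} (j+1)⁴ e^{-j} ≤ 12288`
(`j + 1 ≤ 8 e^{j/8}`, so `(j+1)⁴ e^{-j} ≤ 4096 (e^{-1/2})^j`, and `e^{-1/2} ≤ 2/3`). -/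
theorem sum_pow_four_mul_exp_neg_le (J : ℕ) :
    ∑ j ∈ Finset.range J, ((j : ℝ) + 1) ^ 4 * Real.exp (-(j : ℝ)) ≤ 12288 := by
  have hterm : ∀ j : ℕ, ((j : ℝ) + 1) ^ 4 * Real.exp (-(j : ℝ)) ≤ 4096 * Real.exp (-(1 / 2)) ^ j := by
    intro j
    have h1 : (j : ℝ) + 1 ≤ 8 * Real.exp ((j : ℝ) / 8) := by
      linarith [Real.add_one_le_exp ((j : ℝ) / 8), (Nat.cast_nonneg j : (0 : ℝ) ≤ j)]
    have h2 : ((j : ℝ) + 1) ^ 4 ≤ 4096 * Real.exp ((j : ℝ) / 2) := by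
      calc ((j : ℝ) + 1) ^ 4 ≤ (8 * Real.exp ((j : ℝ) / 8)) ^ 4 :=
            pow_le_pow_left₀ (by positivity) h1 4
        _ = 4096 * Real.exp ((j : ℝ) / 2) := by
            rw [mul_pow, ← Real.exp_nat_mul]; norm_num; ring_nf
    have h3 : Real.exp (-(1 / 2)) ^ j = Real.exp ((j : ℝ) / 2) * Real.exp (-(j : ℝ)) := by
      rw [← Real.exp_nat_mul, ← Real.exp_add]; ring_nf
    rw [h3, ← mul_assoc]
    exact mul_le_mul_of_nonneg_right h2 (Real.exp_pos _).le
  have hr1 : Real.exp (-(1 / 2 : ℝ)) ≤ 2 / 3 := by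
    rw [Real.exp_neg, inv_le_comm₀ (Real.exp_pos _) (by norm_num)]
    linarith [Real.add_one_le_exp (1 / 2 : ℝ)]
  have hgeom : ∑ j ∈ Finset.range J, Real.exp (-(1 / 2 : ℝ)) ^ j ≤ 3 := by
    have h := geom_sum_Ico_le_of_lt_one (m := 0) (n := J) (Real.exp_pos _).le (by linarith)
    rw [← Finset.range_eq_Ico, pow_zero] at h
    exact h.trans (by rw [div_le_iff₀ (by linarith)]; linarith)
  calc ∑ j ∈ Finset.range J, ((j : ℝ) + 1) ^ 4 * Real.exp (-(j : ℝ))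
      ≤ ∑ j ∈ Finset.range J, 4096 * Real.exp (-(1 / 2)) ^ j := Finset.sum_le_sum fun j _ => hterm j
    _ = 4096 * ∑ j ∈ Finset.range J, Real.exp (-(1 / 2)) ^ j := by rw [Finset.mul_sum]
    _ ≤ 4096 * 3 := by gcongr
    _ = 12288 := by norm_num

/-- **Shell counting.**  If `u_i ≥ x₀ > 0` and `#{i : u_i ≤ x} ≤ C (1 + x)⁴` for all `x ≥ 0`, then
`Σ_i E₁(u_i²) ≤ 12288 · C (2 + x₀)⁴ e^{-x₀²}/x₀²` (shells `x₀ + j ≤ u_i < x₀ + j + 1`,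
`E₁(y) ≤ e^{-y}/y`, `(x₀+j)² ≥ x₀² + j`, `(2+x₀+j)⁴ ≤ (2+x₀)⁴(j+1)⁴`). -/
theorem sum_expInt_sq_le {ι : Type*} [Fintype ι] (u : ι → ℝ) {x₀ C : ℝ} (hx₀ : 0 < x₀)
    (hC : 0 ≤ C) (hu : ∀ i, x₀ ≤ u i)
    (hcount : ∀ x : ℝ, 0 ≤ x →
      ((Finset.univ.filter fun i => u i ≤ x).card : ℝ) ≤ C * (1 + x) ^ 4) :
    ∑ i, ∫ s in Set.Ioi (u i ^ 2), Real.exp (-s) / s ≤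
      C * 12288 * ((2 + x₀) ^ 4 * Real.exp (-x₀ ^ 2) / x₀ ^ 2) := by
  set sh : ι → ℕ := fun i => ⌊u i - x₀⌋₊ with hsh
  have hsh1 : ∀ i, x₀ + sh i ≤ u i := fun i => by
    have := Nat.floor_le (sub_nonneg.2 (hu i)); simp only [hsh]; linarith
  have hsh2 : ∀ i, u i < x₀ + sh i + 1 := fun i => by
    have := Nat.lt_floor_add_one (u i - x₀); simp only [hsh]; linarith
  have hJ : ∀ i ∈ (Finset.univ : Finset ι), sh i ∈ Finset.range (Finset.univ.sup sh + 1) :=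
    fun i _ => Finset.mem_range.2 (Nat.lt_succ_of_le (Finset.le_sup (Finset.mem_univ i)))
  rw [← Finset.sum_fiberwise_of_maps_to hJ]
  have hshell : ∀ j ∈ Finset.range (Finset.univ.sup sh + 1),
      ∑ i ∈ Finset.univ.filter (fun i => sh i = j), ∫ s in Set.Ioi (u i ^ 2), Real.exp (-s) / s ≤
        C * (2 + x₀) ^ 4 * Real.exp (-x₀ ^ 2) / x₀ ^ 2 *
          (((j : ℝ) + 1) ^ 4 * Real.exp (-(j : ℝ))) := by
    intro j _
    have hj0 : (0 : ℝ) ≤ j := Nat.cast_nonneg j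
    have hxj : 0 < x₀ + j := by positivity
    have h2 : ((Finset.univ.filter (fun i => sh i = j)).card : ℝ) ≤ C * (2 + x₀ + j) ^ 4 := by
      have hsub : Finset.univ.filter (fun i => sh i = j) ⊆
          Finset.univ.filter (fun i => u i ≤ x₀ + j + 1) := fun i hi => by
        simp only [Finset.mem_filter, Finset.mem_univ, true_and] at hi ⊢
        have := hsh2 i
        rw [hi] at this
        exact this.le
      calc ((Finset.univ.filter (fun i => sh i = j)).card : ℝ)
          ≤ (Finset.univ.filter (fun i => u i ≤ x₀ + j + 1)).card := by
            exact_mod_cast Finset.card_le_card hsub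
        _ ≤ C * (1 + (x₀ + j + 1)) ^ 4 := hcount _ (by positivity)
        _ = C * (2 + x₀ + j) ^ 4 := by ring
    have h3 : ∫ s in Set.Ioi ((x₀ + j) ^ 2), Real.exp (-s) / s ≤
        Real.exp (-x₀ ^ 2) / x₀ ^ 2 * Real.exp (-(j : ℝ)) := by
      refine (frullani_expInt_nonneg_le _ (by positivity)).2.trans ?_
      rw [div_mul_eq_mul_div, ← Real.exp_add]
      have hjj : (j : ℝ) ≤ (j : ℝ) ^ 2 := by exact_mod_cast Nat.le_self_pow two_ne_zero j
      exact div_le_div₀ (Real.exp_pos _).le (Real.exp_le_exp.2 (by nlinarith)) (by positivity)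
        (pow_le_pow_left₀ hx₀.le (by linarith) 2)
    have h4 : (2 + x₀ + j : ℝ) ^ 4 ≤ (2 + x₀) ^ 4 * ((j : ℝ) + 1) ^ 4 := by
      rw [← mul_pow]
      exact pow_le_pow_left₀ (by positivity) (by nlinarith) 4
    calc ∑ i ∈ Finset.univ.filter (fun i => sh i = j), ∫ s in Set.Ioi (u i ^ 2), Real.exp (-s) / s
        ≤ ∑ i ∈ Finset.univ.filter (fun i => sh i = j),
            ∫ s in Set.Ioi ((x₀ + j) ^ 2), Real.exp (-s) / s := by
          refine Finset.sum_le_sum fun i hi => expInt_antitone (by positivity) ?_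
          have := hsh1 i
          rw [(Finset.mem_filter.1 hi).2] at this
          exact pow_le_pow_left₀ hxj.le this 2
      _ = (Finset.univ.filter (fun i => sh i = j)).card *
            ∫ s in Set.Ioi ((x₀ + j) ^ 2), Real.exp (-s) / s := by
          rw [Finset.sum_const, nsmul_eq_mul]
      _ ≤ C * (2 + x₀ + j) ^ 4 * (Real.exp (-x₀ ^ 2) / x₀ ^ 2 * Real.exp (-(j : ℝ))) :=
          mul_le_mul h2 h3 (frullani_expInt_nonneg_le _ (by positivity)).1 (by positivity)
      _ ≤ C * ((2 + x₀) ^ 4 * ((j : ℝ) + 1) ^ 4) *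
            (Real.exp (-x₀ ^ 2) / x₀ ^ 2 * Real.exp (-(j : ℝ))) := by gcongr
      _ = _ := by ring
  calc ∑ j ∈ Finset.range (Finset.univ.sup sh + 1),
        ∑ i ∈ Finset.univ.filter (fun i => sh i = j), ∫ s in Set.Ioi (u i ^ 2), Real.exp (-s) / s
      ≤ ∑ j ∈ Finset.range (Finset.univ.sup sh + 1), C * (2 + x₀) ^ 4 * Real.exp (-x₀ ^ 2) /
          x₀ ^ 2 * (((j : ℝ) + 1) ^ 4 * Real.exp (-(j : ℝ))) := Finset.sum_le_sum hshell
    _ ≤ C * (2 + x₀) ^ 4 * Real.exp (-x₀ ^ 2) / x₀ ^ 2 * 12288 := by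
        rw [← Finset.mul_sum]
        gcongr
        exact sum_pow_four_mul_exp_neg_le _
    _ = _ := by ring

/-- The profile `Φ(x) = (2 + x)⁴ e^{-x²}/x²` tends to `0` at `+∞` (`Φ(x) ≤ 81 x⁴ e^{-x}`, `x ≥ 1`). -/
theorem tendsto_profile_atTop :
    Tendsto (fun x : ℝ => (2 + x) ^ 4 * Real.exp (-x ^ 2) / x ^ 2) atTop (𝓝 0) := by
  have hb : Tendsto (fun x : ℝ => 81 * (x ^ 4 * Real.exp (-x))) atTop (𝓝 0) := by
    simpa using (Real.tendsto_pow_mul_exp_neg_atTop_nhds_zero 4).const_mul 81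
  refine squeeze_zero' (Eventually.of_forall fun x => by positivity) ?_ hb
  filter_upwards [eventually_ge_atTop (1 : ℝ)] with x hx
  rw [div_le_iff₀ (by positivity)]
  have h1 : (2 + x) ^ 4 ≤ 81 * x ^ 4 := by
    calc (2 + x) ^ 4 ≤ (3 * x) ^ 4 := pow_le_pow_left₀ (by linarith) (by linarith) 4
      _ = 81 * x ^ 4 := by ring
  have h2 : Real.exp (-x ^ 2) ≤ Real.exp (-x) := Real.exp_le_exp.2 (by nlinarith)
  calc (2 + x) ^ 4 * Real.exp (-x ^ 2) ≤ 81 * x ^ 4 * Real.exp (-x) :=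
        mul_le_mul h1 h2 (Real.exp_pos _).le (by positivity)
    _ = 81 * (x ^ 4 * Real.exp (-x)) * 1 := by ring
    _ ≤ 81 * (x ^ 4 * Real.exp (-x)) * x ^ 2 := by gcongr; nlinarith

/-- `Φ(c/t) → 0` as `t → 0⁺` for `c > 0`. -/
theorem tendsto_profile_div {c : ℝ} (hc : 0 < c) :
    Tendsto (fun t : ℝ => (2 + c / t) ^ 4 * Real.exp (-(c / t) ^ 2) / (c / t) ^ 2)
      (𝓝[>] 0) (𝓝 0) := by
  have h : Tendsto (fun t : ℝ => c * t⁻¹) (𝓝[>] 0) atTop :=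
    tendsto_inv_nhdsGT_zero.const_mul_atTop hc
  exact tendsto_profile_atTop.comp (h.congr fun t => (div_eq_mul_inv c t).symm)

/-! ## Gap from support-form coercivity -/

variable {N : ℕ} [NeZero N]

/-- `Γ₅ = 1 ⊗ 1 ⊗ γ₅` preserves every component modulus (`γ₅ = diag(1,1,−1,−1)`). -/
theorem norm_spinorLift_gammaFive_mulVec_apply (v : TorusSite 4 N × Fin 3 × Fin 4 → ℂ)
    (p : TorusSite 4 N × Fin 3 × Fin 4) : ‖(spinorLift gammaFive *ᵥ v) p‖ = ‖v p‖ := by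
  rw [spinorLift_gammaFive_eq_diagonal, Matrix.mulVec_diagonal, norm_mul]
  have : ‖(![1, 1, -1, -1] : Fin 4 → ℂ) p.2.2‖ = 1 := by
    obtain ⟨x, a, α⟩ := p
    fin_cases α <;> simp
  rw [this, one_mul]

/-- A sum over all quark indices of a function vanishing off `Ω` is the sum over the `Ω`-subtype. -/
theorem sum_eq_sum_subtype_of_support {M : Type*} [AddCommMonoid M] (Ω : TorusSite 4 N → Prop)
    (g : TorusSite 4 N × Fin 3 × Fin 4 → M) (hg : ∀ p, ¬ Ω p.1 → g p = 0) :
    ∑ p, g p = ∑ q : {p : TorusSite 4 N × Fin 3 × Fin 4 // Ω p.1}, g q.1 := by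
  rw [← Finset.sum_subtype (Finset.univ.filter fun p : TorusSite 4 N × Fin 3 × Fin 4 => Ω p.1)
    (by simp) g]
  exact (Finset.sum_filter_of_ne fun p _ hne => by by_contra h; exact hne (hg p h)).symm

/-- **Gap from coercivity.**  If `D_W(U, μ, 1)` is `κ`-coercive on the `Ω`-sites (support form,
`κ > 0`), every eigenvalue of the principal submatrix of `Γ₅ D_W` on the `Ω`-indices has modulus
`≥ κ` (unit eigenvector `w` extended by zero to `v`: `λ² = ‖H_Ω w‖² = Σ_{p ∈ Ω} ‖(D_W v)_p‖² ≥ κ²`). -/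
theorem le_abs_eigenvalues_of_coercive
    (U : GaugeConfig 4 N (Matrix.specialUnitaryGroup (Fin 3) ℂ)) (μ : ℝ) (Ω : TorusSite 4 N → Prop)
    {κ : ℝ} (hκ : 0 < κ)
    (hco : ∀ v : TorusSite 4 N × Fin 3 × Fin 4 → ℂ, (∀ p, ¬ Ω p.1 → v p = 0) →
      κ ^ 2 * ∑ p, ‖v p‖ ^ 2 ≤
        ∑ p ∈ Finset.univ.filter (fun p : TorusSite 4 N × Fin 3 × Fin 4 => Ω p.1),
          ‖(wilsonDirac (fundamentalRep (Fin 3)) U μ 1).mulVec v p‖ ^ 2)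
    (i : {p : TorusSite 4 N × Fin 3 × Fin 4 // Ω p.1}) :
    κ ≤ |((Literature.Barriers.QuantumFields.WilsonDeterminant.isHermitian_hermitianWilsonDirac
        (fundamentalRep (Fin 3)) fundamentalRep_mem_unitaryGroup U μ 1).submatrix
        (Subtype.val : {p : TorusSite 4 N × Fin 3 × Fin 4 // Ω p.1} →
          TorusSite 4 N × Fin 3 × Fin 4)).eigenvalues i| := by
  set D := wilsonDirac (fundamentalRep (Fin 3)) U μ 1
  set A := Literature.Barriers.QuantumFields.WilsonDeterminant.hermitianWilsonDirac
    (fundamentalRep (Fin 3)) U μ 1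
  have hAΩ : (A.submatrix (Subtype.val : {p : TorusSite 4 N × Fin 3 × Fin 4 // Ω p.1} → _)
      Subtype.val).IsHermitian :=
    (Literature.Barriers.QuantumFields.WilsonDeterminant.isHermitian_hermitianWilsonDirac
      (fundamentalRep (Fin 3)) fundamentalRep_mem_unitaryGroup U μ 1).submatrix Subtype.val
  change κ ≤ |hAΩ.eigenvalues i|
  set lam := hAΩ.eigenvalues i
  set b := hAΩ.eigenvectorBasis i
  have hb1 : ∑ q, ‖b q‖ ^ 2 = 1 := by
    rw [← EuclideanSpace.norm_sq_eq, hAΩ.eigenvectorBasis.orthonormal.1 i, one_pow]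
  have hev : (A.submatrix Subtype.val Subtype.val) *ᵥ ⇑b = lam • ⇑b :=
    hAΩ.mulVec_eigenvectorBasis i
  set v : TorusSite 4 N × Fin 3 × Fin 4 → ℂ := fun p => if h : Ω p.1 then b ⟨p, h⟩ else 0
    with hvdef
  have hv_off : ∀ p, ¬ Ω p.1 → v p = 0 := fun p hp => by simp [hvdef, hp]
  have hv_on : ∀ q : {p : TorusSite 4 N × Fin 3 × Fin 4 // Ω p.1}, v q.1 = b q := fun q => by
    simp [hvdef, q.2]
  have hv1 : ∑ p, ‖v p‖ ^ 2 = 1 := by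
    rw [sum_eq_sum_subtype_of_support Ω (fun p => ‖v p‖ ^ 2)
      (fun p hp => by simp [hv_off p hp]), ← hb1]
    exact Finset.sum_congr rfl fun q _ => by rw [hv_on]
  have hAv : ∀ q : {p : TorusSite 4 N × Fin 3 × Fin 4 // Ω p.1},
      (A *ᵥ v) q.1 = (lam : ℂ) * b q := by
    intro q
    have h := congr_fun hev q
    simp only [Pi.smul_apply, Complex.real_smul] at h
    rw [← h]
    simp only [Matrix.mulVec, dotProduct, Matrix.submatrix_apply]
    rw [sum_eq_sum_subtype_of_support Ω (fun p => A q.1 p * v p)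
      (fun p hp => by simp [hv_off p hp])]
    exact Finset.sum_congr rfl fun q' _ => by rw [hv_on]
  have hc := hco v hv_off
  have hR : ∑ p ∈ Finset.univ.filter (fun p : TorusSite 4 N × Fin 3 × Fin 4 => Ω p.1),
      ‖(D *ᵥ v) p‖ ^ 2 = lam ^ 2 := by
    rw [Finset.sum_subtype (p := fun p : TorusSite 4 N × Fin 3 × Fin 4 => Ω p.1)
      (F := inferInstance) (Finset.univ.filter fun p => Ω p.1) (by simp)
      (fun p => ‖(D *ᵥ v) p‖ ^ 2)]
    have h1 : ∀ q : {p : TorusSite 4 N × Fin 3 × Fin 4 // Ω p.1},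
        ‖(D *ᵥ v) q.1‖ = |lam| * ‖b q‖ := by
      intro q
      rw [← norm_spinorLift_gammaFive_mulVec_apply, Matrix.mulVec_mulVec]
      change ‖(A *ᵥ v) q.1‖ = _
      rw [hAv, norm_mul, Complex.norm_real, Real.norm_eq_abs]
    simp_rw [h1, mul_pow, ← Finset.mul_sum, hb1, mul_one, sq_abs]
  rw [hv1, mul_one, hR] at hc
  have h := sq_le_sq.1 hc
  rwa [abs_of_pos hκ] at h

/-! ## The stub -/

/-- **The clean-box bound** — the skeleton's `∀ Nf reg b₀ ℓ m, 0 < ℓ → (∀ f, 0 < m f) →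
CleanBoxBound reg b₀ ℓ m` with `CleanBoxBound`, `BadBox` (`mq`, `Res` = `CellResonant`,
`Ω` = `cleanPart`, `ev` = the Dirichlet spectrum on `Ω`), `localIrFunctional`, `tZero`, `expIntE₁`
unfolded verbatim.  Witness: `η(t) = Σ_f ½ · C_W K⁴ · 12288 · Φ(c_h ℓ m_f / t)`,
`Φ(x) = (2 + x)⁴ e^{-x²}/x²`. -/
theorem cleanBoxBound :
    ∀ (Nf : ℕ) (reg : QCDRegularisation Nf) (b₀ : ℕ) (ℓ : ℝ) (m : Fin Nf → ℝ),
      0 < ℓ → (∀ f, 0 < m f) →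
      ∀ K : ℕ, 0 < K → ∀ ch : ℝ, 0 < ch → ∀ CW : ℝ, 0 < CW →
        ∃ η : ℝ → ℝ, Tendsto η (𝓝[>] 0) (𝓝 0) ∧
          ∀ t : ℝ, 0 < t → t ≤ 1 →
            ∀ (k S : ℕ) (U : GaugeConfig 4 (2 * S + 1) (Matrix.specialUnitaryGroup (Fin 3) ℂ))
              (f : Fin Nf) (y : TorusSite 4 (2 * S + 1)),
            let mq : Fin Nf → ℝ := fun f' => reg.mcrit k + reg.a k * m f' / reg.Zm k;
            let Res : TorusSite 4 (2 * S + 1) → (Fin 4 → ℕ) → Fin Nf → Prop := fun x s f' =>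
              ∃ v : {p // wilsonBox x s p} → ℂ, v ≠ 0 ∧
                ∑ p, ‖(wilsonCell U (mq f') x s).mulVec v p‖ ^ 2 <
                  (t / s 0 / reg.Zm k) ^ 2 * ∑ p, ‖v p‖ ^ 2;
            let Ω : TorusSite 4 (2 * S + 1) → Prop := fun z =>
              siteBox y (fun _ => K * ⌈ℓ / (t * reg.a k)⌉₊) z ∧
                ¬ ∃ (f' : Fin Nf) (x : TorusSite 4 (2 * S + 1)) (s : Fin 4 → ℕ),
                  (∀ i, b₀ ≤ s i ∧ s i ≤ 2 * S + 1 ∧ (s i : ℝ) * reg.a k ≤ ℓ) ∧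
                  (∀ i j, s i ≤ 2 * s j) ∧ siteBox x s z ∧ Res x s f';
            letI : DecidablePred fun p : TorusSite 4 (2 * S + 1) × Fin 3 × Fin 4 => Ω p.1 :=
              fun _ => Classical.propDecidable _;
            let ev : {p : TorusSite 4 (2 * S + 1) × Fin 3 × Fin 4 // Ω p.1} → ℝ :=
              ((Literature.Barriers.QuantumFields.WilsonDeterminant.isHermitian_hermitianWilsonDirac
                (fundamentalRep (Fin 3)) fundamentalRep_mem_unitaryGroup U (mq f) 1).submatrix
                (Subtype.val : {p : TorusSite 4 (2 * S + 1) × Fin 3 × Fin 4 // Ω p.1} →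
                  TorusSite 4 (2 * S + 1) × Fin 3 × Fin 4)).eigenvalues;
            ¬ ((∃ (f' : Fin Nf) (x : TorusSite 4 (2 * S + 1)) (s : Fin 4 → ℕ),
                  (∀ i, b₀ ≤ s i ∧ s i ≤ 2 * S + 1 ∧ (s i : ℝ) * reg.a k ≤ ℓ) ∧
                  (∀ i j, s i ≤ 2 * s j) ∧
                  (∃ z, siteBox x s z ∧ siteBox y (fun _ => K * ⌈ℓ / (t * reg.a k)⌉₊) z) ∧
                  Res x s f') ∨
              (¬ ∀ v : TorusSite 4 (2 * S + 1) × Fin 3 × Fin 4 → ℂ, (∀ p, ¬ Ω p.1 → v p = 0) →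
                  (ch * (reg.a k * m f) / reg.Zm k) ^ 2 * ∑ p, ‖v p‖ ^ 2 ≤
                    ∑ p ∈ Finset.univ.filter
                      (fun p : TorusSite 4 (2 * S + 1) × Fin 3 × Fin 4 => Ω p.1),
                      ‖(wilsonDirac (fundamentalRep (Fin 3)) U (mq f) 1).mulVec v p‖ ^ 2) ∨
              (∃ x : ℝ, 0 ≤ x ∧ CW * ((K : ℝ) + x * K) ^ 4 <
                  (Finset.univ.filter fun i => |ev i| ≤ x * (t * reg.a k / ℓ) / reg.Zm k).card) ∨
              (∃ (f' : Fin Nf) (j : ℕ) (x : TorusSite 4 (2 * S + 1)) (s : Fin 4 → ℕ),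
                  j < Nat.log 2 (⌊ℓ / reg.a k⌋₊ / b₀) + 1 ∧
                  (∀ i, b₀ * 2 ^ j ≤ s i ∧ s i < b₀ * 2 ^ (j + 2) ∧ s i ≤ 2 * S + 1 ∧
                    (s i : ℝ) * reg.a k ≤ ℓ) ∧
                  (∃ z, siteBox x s z ∧ siteBox y (fun _ => K * ⌈ℓ / (t * reg.a k)⌉₊) z) ∧
                  IsSignDefect (fun e => U (e.1 + x, e.2)) (mq f') j s)) →
            (1 / 2 : ℝ) * ∑ i, (∫ s in Set.Ioi ((ℓ / t * reg.Zm k / reg.a k) ^ 2 * ev i ^ 2),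
              Real.exp (-s) / s) ≤ η t := by
  intro Nf reg b₀ ℓ m hℓ hm K hK ch hch CW hCW
  refine ⟨fun t => ∑ f, (1 / 2 : ℝ) * (CW * (K : ℝ) ^ 4 * 12288 *
    ((2 + ch * ℓ * m f / t) ^ 4 * Real.exp (-(ch * ℓ * m f / t) ^ 2) / (ch * ℓ * m f / t) ^ 2)),
    ?_, ?_⟩
  · have h : ∀ f ∈ (Finset.univ : Finset (Fin Nf)), Tendsto (fun t : ℝ => (1 / 2 : ℝ) *
        (CW * (K : ℝ) ^ 4 * 12288 * ((2 + ch * ℓ * m f / t) ^ 4 *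
          Real.exp (-(ch * ℓ * m f / t) ^ 2) / (ch * ℓ * m f / t) ^ 2))) (𝓝[>] 0) (𝓝 0) := by
      intro f _
      have hmf := hm f
      simpa using ((tendsto_profile_div (c := ch * ℓ * m f) (by positivity)).const_mul
        (CW * (K : ℝ) ^ 4 * 12288)).const_mul (1 / 2 : ℝ)
    simpa using tendsto_finsetSum _ h
  · intro t ht ht1 k S U f y mq Res Ω
    -- as in the statement: every decidability instance on `Ω` is the classical one
    letI : DecidablePred fun p : TorusSite 4 (2 * S + 1) × Fin 3 × Fin 4 => Ω p.1 :=
      fun _ => Classical.propDecidable _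
    intro ev hbad
    have hco := not_not.1 (not_or.1 (not_or.1 hbad).2).1
    have h3 := (not_or.1 (not_or.1 (not_or.1 hbad).2).2).1
    have hcnt : ∀ x : ℝ, 0 ≤ x →
        ((Finset.univ.filter fun i => |ev i| ≤ x * (t * reg.a k / ℓ) / reg.Zm k).card : ℝ) ≤
          CW * ((K : ℝ) + x * K) ^ 4 :=
      fun x hx => not_lt.1 fun h => h3 ⟨x, hx, h⟩
    clear hbad h3
    obtain ⟨ha, hZ, hmf⟩ : 0 < reg.a k ∧ 0 < reg.Zm k ∧ 0 < m f := ⟨reg.a_pos k, reg.Zm_pos k, hm f⟩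
    have hKr : (0 : ℝ) < K := by exact_mod_cast hK
    set κ := ch * (reg.a k * m f) / reg.Zm k with hκdef
    have hκ : 0 < κ := by positivity
    set τ := t * reg.a k / ℓ / reg.Zm k with hτdef
    have hτ : 0 < τ := by positivity
    set x₀ := ch * ℓ * m f / t with hx₀def
    have hx₀ : 0 < x₀ := by positivity
    have hκτ : κ / τ = x₀ := by simp only [hκdef, hτdef, hx₀def]; field_simp
    set u : {p : TorusSite 4 (2 * S + 1) × Fin 3 × Fin 4 // Ω p.1} → ℝ := fun i => |ev i| / τ
      with hu
    have hu0 : ∀ i, x₀ ≤ u i := fun i => by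
      rw [← hκτ]
      exact div_le_div_of_nonneg_right (le_abs_eigenvalues_of_coercive U (mq f) Ω hκ hco i) hτ.le
    have hcount : ∀ x : ℝ, 0 ≤ x →
        ((Finset.univ.filter fun i => u i ≤ x).card : ℝ) ≤ CW * (K : ℝ) ^ 4 * (1 + x) ^ 4 := by
      intro x hx
      have hset : (Finset.univ.filter fun i => u i ≤ x) =
          Finset.univ.filter fun i => |ev i| ≤ x * (t * reg.a k / ℓ) / reg.Zm k := by
        refine Finset.filter_congr fun i _ => ?_
        rw [hu, div_le_iff₀ hτ, show x * τ = x * (t * reg.a k / ℓ) / reg.Zm k by rw [hτdef]; ring]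
      rw [hset, show CW * (K : ℝ) ^ 4 * (1 + x) ^ 4 = CW * ((K : ℝ) + x * K) ^ 4 by ring]
      exact hcnt x hx
    have ht0 : ∀ i, (ℓ / t * reg.Zm k / reg.a k) ^ 2 * ev i ^ 2 = u i ^ 2 := fun i => by
      simp only [hu, hτdef]; rw [← sq_abs (ev i)]; field_simp
    simp_rw [ht0]
    calc (1 / 2 : ℝ) * ∑ i, ∫ s in Set.Ioi (u i ^ 2), Real.exp (-s) / s
        ≤ (1 / 2) * (CW * (K : ℝ) ^ 4 * 12288 * ((2 + x₀) ^ 4 * Real.exp (-x₀ ^ 2) / x₀ ^ 2)) := by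
          gcongr
          exact sum_expInt_sq_le u hx₀ (by positivity) hu0 hcount
      _ ≤ ∑ f', (1 / 2 : ℝ) * (CW * (K : ℝ) ^ 4 * 12288 * ((2 + ch * ℓ * m f' / t) ^ 4 *
            Real.exp (-(ch * ℓ * m f' / t) ^ 2) / (ch * ℓ * m f' / t) ^ 2)) :=
          Finset.single_le_sum (f := fun f' => (1 / 2 : ℝ) * (CW * (K : ℝ) ^ 4 * 12288 *
              ((2 + ch * ℓ * m f' / t) ^ 4 * Real.exp (-(ch * ℓ * m f' / t) ^ 2) /
                (ch * ℓ * m f' / t) ^ 2))) (fun f' _ => by positivity) (Finset.mem_univ f)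

end Summit.QuantumFields.QCD.Cruxes.SeaFactorisationBridge.ProperTimeQuarantine.CleanBox

end
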